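import Summits.QuantumFields.YangMills.Theorems.ColdStartUniversalityLatticeLangevinTransportMixingOfLogSobolevColdStart
import Summits.QuantumFields.YangMills.Theorems.ColdStartUniversalityLatticeLangevinMacroscopicMixing
import HarnessLib

/-!
# Route `ColdStartUniversality` (fixed-cut-off package): COLD-START EQUILIBRATION OF THE ACTION DENSITY AND OF SPATIALLY AVERAGED WILSON LOOPS
# FROM A LOG-SOBOLEV INEQUALITY WITH AN ARBITRARY CONSTANT `ρ` (every coupling `β'`)

Helper file (seat `ym-line-csu-p1`, g28; `--supports stmt-QuantumFields-24809`).  The `ρ`-parametric transport bound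
`wilson_coldStart_smooth_le_exp_of_logSobolev_explicit` (`|E F(U_(2+u)) − μ_(β')F| ≤ e^(−2ρu)·√(s·B_L/(2ρ))`) read on g27's two macroscopic
observables (carré bounds `Γ(S_W/#𝒫) ≤ 64/#𝒫`, `Γ(W̄_(R×T)) ≤ 96(R+T)²/#sites`), under a HYPOTHESIS log-Sobolev inequality with constant `ρ`:
* ★★ `wilson_coldStart_actionDensity_le_exp_of_logSobolev` — `|E S_W(U_(2+u))/#𝒫 − ∫S_W/#𝒫 dμ_(β')| ≤ e^(−2ρu)·√(64·B_L/(#𝒫·2ρ))`;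
* ★★ `wilson_coldStart_loopAverage_le_exp_of_logSobolev` — `|E W̄(U_(2+u)) − ∫W̄ dμ_(β')| ≤ e^(−2ρu)·√(96(R+T)²·B_L/(#sites·2ρ))`;
* ★★ `wilson_coldStart_loopAverage_le_coupling_of_logSobolev` — the volume factors cancelled: `≤ e^(−2ρu)·(R+T)·√(48(366|β'| + 3)/ρ)`
  (`B_L ≤ (366|β'| + 3)L³`), i.e. the prefactor depends on `L` and `β'` ONLY through `β'` and `ρ`.
Why: with `ρ = c·ε_K` and `β' = β'_K = (γε_K)⁻¹/2` (the route's (ULS) of LINE 4) the prefactor is `O(ε_K⁻¹)`, whence physical equilibration times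
`O(log(1/ε_K))` — see `…UniformColdStartMixingNearUniformOfLogSobolev`.  HONEST FRAMING: FIXED cut-off; log-Sobolev is a HYPOTHESIS; nothing K-uniform;
24809 ASIDE not restated; no crux, rung or summit statement is proved; the Yang–Mills mass gap is NOT proved.  THEOREMS ONLY, no definition, no sorry.
[cite: BakryGentilLedoux2014, Thm 5.2.1]
-/

set_option autoImplicit false

noncomputable section

namespace Summit.QuantumFields.YangMills.Theorems.ColdStartUniversality

open MeasureTheory ProbabilityTheory Finset Filter Set InformationTheory
open scoped BigOperators NNReal ENNReal Topology Matrix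
open Literature.Probability.Process Literature.MathematicalPhysics.QuantumFieldTheory
open Literature.MathematicalPhysics.QuantumLattice (fundamentalRep fundamentalLatticeRep continuous_fundamentalRep)

variable {L : ℕ} [NeZero L]

/-! ## §1. The action density -/

/-- ★★ **Cold-start equilibration of the action density from log-Sobolev(`ρ`)** (every `β'`): for every deterministic start, every solution and
every `u ≥ 0`, `|E S_W(U_(2+u))/#𝒫 − ∫ S_W/#𝒫 dμ_(β')| ≤ e^(−2ρu) · √(64·(366|β'|L³ + 3 log(3/2) L³ + log 2)/(#𝒫·(2ρ)))`.
[cite: BakryGentilLedoux2014, Thm 5.2.1] -/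
theorem wilson_coldStart_actionDensity_le_exp_of_logSobolev (L : ℕ) [NeZero L] (β' : ℝ) {ρ : ℝ} (hρ : 0 < ρ)
    (z : (GaugeConfig 3 L (Matrix.specialUnitaryGroup (Fin 2) ℂ)))
    (hLSgen : ∀ (f : (Edge 3 L × Fin 2 × Fin 2 × Bool → ℝ) → ℝ), ContDiff ℝ 3 f →
        let coords : GaugeConfig 3 L (Matrix.specialUnitaryGroup (Fin 2) ℂ) → (Edge 3 L × Fin 2 × Fin 2 × Bool → ℝ) :=
          fun V q => (fun z : ℂ => if q.2.2.2 then z.im else z.re)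
            ((fundamentalRep (Fin 2) (V q.1) : Matrix (Fin 2) (Fin 2) ℂ) q.2.1 q.2.2.1)
        let gen : GaugeConfig 3 L (Matrix.specialUnitaryGroup (Fin 2) ℂ) → ℝ := fun V =>
          (∑ i : Edge 3 L × Fin 2 × Fin 2 × Bool, fderiv ℝ f (coords V) (Pi.single i 1) *
              (fun z : ℂ => if i.2.2.2 then z.im else z.re)
                ((latticeLangevinDynamics (fundamentalLatticeRep 2) β').drift
                  (matrixConfig (fundamentalRep (Fin 2)) V) i.1 i.2.1 i.2.2.1) +
          1 / 2 * ∑ i : Edge 3 L × Fin 2 × Fin 2 × Bool, ∑ j : Edge 3 L × Fin 2 × Fin 2 × Bool,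
            fderiv ℝ (fun z => fderiv ℝ f z (Pi.single i 1)) (coords V) (Pi.single j 1) *
              ∑ n : Edge 3 L × NoiseIdx 2,
                (if n.1 = i.1 then (fun z : ℂ => if i.2.2.2 then z.im else z.re)
                  ((latticeLangevinDynamics (fundamentalLatticeRep 2) β').noise
                    (matrixConfig (fundamentalRep (Fin 2)) V) i.1 n.2 i.2.1 i.2.2.1) else 0) *
                (if n.1 = j.1 then (fun z : ℂ => if j.2.2.2 then z.im else z.re)
                  ((latticeLangevinDynamics (fundamentalLatticeRep 2) β').noise
                    (matrixConfig (fundamentalRep (Fin 2)) V) j.1 n.2 j.2.1 j.2.2.1) else 0))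
        ρ * ((∫ V, f (coords V) ^ 2 * Real.log (f (coords V) ^ 2) ∂(wilsonMeasure (d := 3) (L := L) (fundamentalRep (Fin 2)) β')) -
            (∫ V, f (coords V) ^ 2 ∂(wilsonMeasure (d := 3) (L := L) (fundamentalRep (Fin 2)) β')) *
              Real.log (∫ V, f (coords V) ^ 2 ∂(wilsonMeasure (d := 3) (L := L) (fundamentalRep (Fin 2)) β'))) ≤
          -∫ V, f (coords V) * gen V ∂(wilsonMeasure (d := 3) (L := L) (fundamentalRep (Fin 2)) β'))
    {Ω : Type} [MeasurableSpace Ω] {P : Measure Ω} [IsProbabilityMeasure P]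
    {W : ℝ≥0 → Ω → (Edge 3 L × NoiseIdx 2 → ℝ)} (hW : IsFlatBrownian W P)
    {U : ℝ≥0 → Ω → (GaugeConfig 3 L (Matrix.specialUnitaryGroup (Fin 2) ℂ))} (hU0 : ∀ ω, U 0 ω = z)
    (hU : (latticeLangevinDynamics (fundamentalLatticeRep 2) β').IsSolution (fundamentalRep (Fin 2)) hW.natFiltration P W U)
    (u : ℝ≥0) :
    |(∫ ω, wilsonAction (fundamentalRep (Fin 2)) (U ((2 : ℝ≥0) + u) ω) / (Fintype.card (Plaquette 3 L) : ℝ) ∂P) -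
        ∫ V, wilsonAction (fundamentalRep (Fin 2)) V / (Fintype.card (Plaquette 3 L) : ℝ) ∂(wilsonMeasure (d := 3) (L := L) (fundamentalRep (Fin 2)) β')| ≤
      Real.exp (-(2 * ρ) * u) * Real.sqrt (64 * (366 * |β'| * (L : ℝ) ^ 3 + 3 * Real.log (3 / 2) * (L : ℝ) ^ 3 + Real.log 2) / ((Fintype.card (Plaquette 3 L) : ℝ) * (2 * ρ))) := by
  classical
  haveI := secondCountableTopology_su2
  haveI := borelSpace_config L
  set μ : Measure (GaugeConfig 3 L (Matrix.specialUnitaryGroup (Fin 2) ℂ)) := (wilsonMeasure (d := 3) (L := L) (fundamentalRep (Fin 2)) β') with hμ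
  haveI : IsProbabilityMeasure μ :=
    isProbabilityMeasure_wilsonMeasure (d := 3) (L := L) (fundamentalRep (Fin 2)) (continuous_fundamentalRep (Fin 2)) β'
  have h2ρ : 0 < 2 * ρ := by positivity
  set nP : ℝ := (Fintype.card (Plaquette 3 L) : ℝ) with hnP
  have hnPpos : 0 < nP := card_plaquette_three_pos L
  set b : ℝ := nP⁻¹ with hb
  set co : (GaugeConfig 3 L (Matrix.specialUnitaryGroup (Fin 2) ℂ)) → (Edge 3 L × Fin 2 × Fin 2 × Bool → ℝ) := (fun (V : GaugeConfig 3 L (Matrix.specialUnitaryGroup (Fin 2) ℂ)) (q : Edge 3 L × Fin 2 × Fin 2 × Bool) => (fun z : ℂ => if q.2.2.2 then z.im else z.re) ((fundamentalRep (Fin 2) (V q.1) : Matrix (Fin 2) (Fin 2) ℂ) q.2.1 q.2.2.1)) with hco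
  set fp : (Edge 3 L × Fin 2 × Fin 2 × Bool → ℝ) → ℝ := (fun y : (Edge 3 L × Fin 2 × Fin 2 × Bool → ℝ) => b * ∑ p : Plaquette 3 L, (rootedLoop (fun (ee : Edge 3 L) (i j : Fin 2) => ((y (ee, i, j, false) : ℝ) : ℂ) + ((y (ee, i, j, true) : ℝ) : ℂ) * Complex.I) (p.1, p.2.1.1) p.2.1.2 false).trace.re) with hfp
  have hfpC : ContDiff ℝ 3 fp := contDiff_psiHat (d := 3) (L := L) (N := 2) (n := 3) b
  have hval : ∀ V, fp (co V) = 2 - wilsonAction (fundamentalRep (Fin 2)) V / nP := by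
    intro V
    have h : fp (co V) = 2 * b * nP - b * wilsonAction (fundamentalRep (Fin 2)) V := psiHat_coords_eq_wilsonAction b V
    rw [h, div_eq_mul_inv, hb]
    have : 2 * nP⁻¹ * nP = 2 := by rw [mul_assoc, inv_mul_cancel₀ hnPpos.ne', mul_one]
    rw [this]; ring
  have hs : 0 < 64 * b ^ 2 * nP := by positivity
  have hmain : |(∫ ω, fp (co (U ((2 : ℝ≥0) + u) ω)) ∂P) - ∫ V, fp (co V) ∂μ| ≤
      Real.exp (-(2 * ρ) * u) * Real.sqrt ((64 * b ^ 2 * nP) * (366 * |β'| * (L : ℝ) ^ 3 + 3 * Real.log (3 / 2) * (L : ℝ) ^ 3 + Real.log 2) / (2 * ρ)) :=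
    wilson_coldStart_smooth_le_exp_of_logSobolev_explicit L β' fp hρ hfpC hs hLSgen hW z hU0 hU u (wilson_plaquette_carre_le L β' b)
  have hmU : ∀ t : ℝ≥0, Measurable (U t) := fun t => (hU.adapted t).mono (hW.natFiltration.le t) le_rfl
  have hSc : Continuous fun V : (GaugeConfig 3 L (Matrix.specialUnitaryGroup (Fin 2) ℂ)) => wilsonAction (fundamentalRep (Fin 2)) V / nP := by
    have hfun : (fun V : (GaugeConfig 3 L (Matrix.specialUnitaryGroup (Fin 2) ℂ)) => wilsonAction (fundamentalRep (Fin 2)) V / nP) = fun V => 2 - fp (co V) := funext fun V => by rw [hval]; ring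
    rw [hfun]
    exact continuous_const.sub (hfpC.continuous.comp (continuous_coords (L := L)))
  obtain ⟨M, hM⟩ : ∃ M, ∀ V : (GaugeConfig 3 L (Matrix.specialUnitaryGroup (Fin 2) ℂ)), ‖wilsonAction (fundamentalRep (Fin 2)) V / nP‖ ≤ M := by
    obtain ⟨M, hM⟩ := isCompact_univ.exists_bound_of_continuousOn hSc.continuousOn
    exact ⟨M, fun V => hM V (Set.mem_univ V)⟩
  have hintP : Integrable (fun ω => wilsonAction (fundamentalRep (Fin 2)) (U ((2 : ℝ≥0) + u) ω) / nP) P :=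
    Integrable.of_bound ((hSc.measurable.comp (hmU _)).aestronglyMeasurable) M (ae_of_all _ fun ω => hM _)
  have hintμ : Integrable (fun V => wilsonAction (fundamentalRep (Fin 2)) V / nP) μ := integrable_of_continuous_of_compactSpace hSc _
  have hEP : ∫ ω, fp (co (U ((2 : ℝ≥0) + u) ω)) ∂P = 2 - ∫ ω, wilsonAction (fundamentalRep (Fin 2)) (U ((2 : ℝ≥0) + u) ω) / nP ∂P := by
    have hfun : (fun ω => fp (co (U ((2 : ℝ≥0) + u) ω))) = fun ω => (2 : ℝ) - wilsonAction (fundamentalRep (Fin 2)) (U ((2 : ℝ≥0) + u) ω) / nP := funext fun ω => hval _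
    rw [hfun, integral_sub (integrable_const _) hintP, integral_const]
    simp
  have hEμ : ∫ V, fp (co V) ∂μ = 2 - ∫ V, wilsonAction (fundamentalRep (Fin 2)) V / nP ∂μ := by
    have hfun : (fun V => fp (co V)) = fun V => (2 : ℝ) - wilsonAction (fundamentalRep (Fin 2)) V / nP := funext hval
    rw [hfun, integral_sub (integrable_const _) hintμ, integral_const]
    simp
  rw [hEP, hEμ] at hmain
  have e1 : |(2 - ∫ ω, wilsonAction (fundamentalRep (Fin 2)) (U ((2 : ℝ≥0) + u) ω) / nP ∂P) - (2 - ∫ V, wilsonAction (fundamentalRep (Fin 2)) V / nP ∂μ)| =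
      |(∫ ω, wilsonAction (fundamentalRep (Fin 2)) (U ((2 : ℝ≥0) + u) ω) / nP ∂P) - ∫ V, wilsonAction (fundamentalRep (Fin 2)) V / nP ∂μ| := by
    rw [← abs_neg]; congr 1; ring
  rw [e1] at hmain
  have e2 : (64 * b ^ 2 * nP) * (366 * |β'| * (L : ℝ) ^ 3 + 3 * Real.log (3 / 2) * (L : ℝ) ^ 3 + Real.log 2) / (2 * ρ) = 64 * (366 * |β'| * (L : ℝ) ^ 3 + 3 * Real.log (3 / 2) * (L : ℝ) ^ 3 + Real.log 2) / (nP * (2 * ρ)) := by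
    rw [hb]
    field_simp
  rw [e2] at hmain
  exact hmain

/-! ## §2. Spatially averaged Wilson loops -/

/-- ★★ **Cold-start equilibration of the spatially averaged `R × T` Wilson loop from log-Sobolev(`ρ`)** (every `β'`, `R + T > 0`): for every
deterministic start, every solution and every `u ≥ 0`, with `W̄ = (#sites)⁻¹ Σ_x W_(R×T)(x; i, j)`,
`|E W̄(U_(2+u)) − ∫ W̄ dμ_(β')| ≤ e^(−2ρu) · √(96(R+T)²·(366|β'|L³ + 3 log(3/2) L³ + log 2)/(#sites·(2ρ)))`. [cite: BakryGentilLedoux2014, Thm 5.2.1] -/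
theorem wilson_coldStart_loopAverage_le_exp_of_logSobolev (L : ℕ) [NeZero L] (β' : ℝ) {ρ : ℝ} (hρ : 0 < ρ) (i j : Fin 3) (R T : ℕ)
    (hRT : 0 < R + T) (z : (GaugeConfig 3 L (Matrix.specialUnitaryGroup (Fin 2) ℂ)))
    (hLSgen : ∀ (f : (Edge 3 L × Fin 2 × Fin 2 × Bool → ℝ) → ℝ), ContDiff ℝ 3 f →
        let coords : GaugeConfig 3 L (Matrix.specialUnitaryGroup (Fin 2) ℂ) → (Edge 3 L × Fin 2 × Fin 2 × Bool → ℝ) :=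
          fun V q => (fun z : ℂ => if q.2.2.2 then z.im else z.re)
            ((fundamentalRep (Fin 2) (V q.1) : Matrix (Fin 2) (Fin 2) ℂ) q.2.1 q.2.2.1)
        let gen : GaugeConfig 3 L (Matrix.specialUnitaryGroup (Fin 2) ℂ) → ℝ := fun V =>
          (∑ i : Edge 3 L × Fin 2 × Fin 2 × Bool, fderiv ℝ f (coords V) (Pi.single i 1) *
              (fun z : ℂ => if i.2.2.2 then z.im else z.re)
                ((latticeLangevinDynamics (fundamentalLatticeRep 2) β').drift
                  (matrixConfig (fundamentalRep (Fin 2)) V) i.1 i.2.1 i.2.2.1) +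
          1 / 2 * ∑ i : Edge 3 L × Fin 2 × Fin 2 × Bool, ∑ j : Edge 3 L × Fin 2 × Fin 2 × Bool,
            fderiv ℝ (fun z => fderiv ℝ f z (Pi.single i 1)) (coords V) (Pi.single j 1) *
              ∑ n : Edge 3 L × NoiseIdx 2,
                (if n.1 = i.1 then (fun z : ℂ => if i.2.2.2 then z.im else z.re)
                  ((latticeLangevinDynamics (fundamentalLatticeRep 2) β').noise
                    (matrixConfig (fundamentalRep (Fin 2)) V) i.1 n.2 i.2.1 i.2.2.1) else 0) *
                (if n.1 = j.1 then (fun z : ℂ => if j.2.2.2 then z.im else z.re)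
                  ((latticeLangevinDynamics (fundamentalLatticeRep 2) β').noise
                    (matrixConfig (fundamentalRep (Fin 2)) V) j.1 n.2 j.2.1 j.2.2.1) else 0))
        ρ * ((∫ V, f (coords V) ^ 2 * Real.log (f (coords V) ^ 2) ∂(wilsonMeasure (d := 3) (L := L) (fundamentalRep (Fin 2)) β')) -
            (∫ V, f (coords V) ^ 2 ∂(wilsonMeasure (d := 3) (L := L) (fundamentalRep (Fin 2)) β')) *
              Real.log (∫ V, f (coords V) ^ 2 ∂(wilsonMeasure (d := 3) (L := L) (fundamentalRep (Fin 2)) β'))) ≤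
          -∫ V, f (coords V) * gen V ∂(wilsonMeasure (d := 3) (L := L) (fundamentalRep (Fin 2)) β'))
    {Ω : Type} [MeasurableSpace Ω] {P : Measure Ω} [IsProbabilityMeasure P]
    {W : ℝ≥0 → Ω → (Edge 3 L × NoiseIdx 2 → ℝ)} (hW : IsFlatBrownian W P)
    {U : ℝ≥0 → Ω → (GaugeConfig 3 L (Matrix.specialUnitaryGroup (Fin 2) ℂ))} (hU0 : ∀ ω, U 0 ω = z)
    (hU : (latticeLangevinDynamics (fundamentalLatticeRep 2) β').IsSolution (fundamentalRep (Fin 2)) hW.natFiltration P W U)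
    (u : ℝ≥0) :
    |(∫ ω, (((Fintype.card (Site 3 L) : ℝ))⁻¹ * ∑ x : Site 3 L, wilsonLoop (fundamentalRep (Fin 2)) x i j R T (U ((2 : ℝ≥0) + u) ω)) ∂P) - ∫ V, (((Fintype.card (Site 3 L) : ℝ))⁻¹ * ∑ x : Site 3 L, wilsonLoop (fundamentalRep (Fin 2)) x i j R T V) ∂(wilsonMeasure (d := 3) (L := L) (fundamentalRep (Fin 2)) β')| ≤
      Real.exp (-(2 * ρ) * u) * Real.sqrt (96 * ((R : ℝ) + T) ^ 2 * (366 * |β'| * (L : ℝ) ^ 3 + 3 * Real.log (3 / 2) * (L : ℝ) ^ 3 + Real.log 2) / ((Fintype.card (Site 3 L) : ℝ) * (2 * ρ))) := by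
  classical
  haveI := secondCountableTopology_su2
  haveI := borelSpace_config L
  set μ : Measure (GaugeConfig 3 L (Matrix.specialUnitaryGroup (Fin 2) ℂ)) := (wilsonMeasure (d := 3) (L := L) (fundamentalRep (Fin 2)) β') with hμ
  haveI : IsProbabilityMeasure μ :=
    isProbabilityMeasure_wilsonMeasure (d := 3) (L := L) (fundamentalRep (Fin 2)) (continuous_fundamentalRep (Fin 2)) β'
  have h2ρ : 0 < 2 * ρ := by positivity
  have hS : (0 : ℝ) < (Fintype.card (Site 3 L) : ℝ) := card_site_three_pos L
  have hRT' : (0 : ℝ) < (R : ℝ) + T := by exact_mod_cast hRT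
  set co : (GaugeConfig 3 L (Matrix.specialUnitaryGroup (Fin 2) ℂ)) → (Edge 3 L × Fin 2 × Fin 2 × Bool → ℝ) := (fun (V : GaugeConfig 3 L (Matrix.specialUnitaryGroup (Fin 2) ℂ)) (q : Edge 3 L × Fin 2 × Fin 2 × Bool) => (fun z : ℂ => if q.2.2.2 then z.im else z.re) ((fundamentalRep (Fin 2) (V q.1) : Matrix (Fin 2) (Fin 2) ℂ) q.2.1 q.2.2.1)) with hco
  set fp : (Edge 3 L × Fin 2 × Fin 2 × Bool → ℝ) → ℝ := (fun y : (Edge 3 L × Fin 2 × Fin 2 × Bool → ℝ) => (2 * (Fintype.card (Site 3 L) : ℝ))⁻¹ * ∑ x : Site 3 L, ((((((List.range R).map (fun m : ℕ => ((Pi.single i ((m : ℕ) : ZMod L) : Site 3 L), i, false)) ++ (List.range T).map (fun m : ℕ => ((Pi.single i ((R : ℕ) : ZMod L) : Site 3 L) + (Pi.single j ((m : ℕ) : ZMod L) : Site 3 L), j, false)) ++ ((List.range R).map (fun m : ℕ => ((Pi.single j ((T : ℕ) : ZMod L) : Site 3 L) + (Pi.single i ((m : ℕ) : ZMod L) : Site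 3 L), i, true))).reverse ++ ((List.range T).map (fun m : ℕ => ((Pi.single j ((m : ℕ) : ZMod L) : Site 3 L), j, true))).reverse).map (fun q : Site 3 L × Fin 3 × Bool => ((x + q.1, q.2.1), q.2.2))).map (fun a : Edge 3 L × Bool => if a.2 then ((fun (ee : Edge 3 L) => Matrix.of fun (i j : Fin 2) => ((y (ee, i, j, false) : ℝ) : ℂ) + ((y (ee, i, j, true) : ℝ) : ℂ) * Complex.I) a.1)ᴴ else (fun (ee : Edge 3 L) => Matrix.of fun (i j : Fin 2) => ((y (ee, i, j, false) : ℝ) : ℂ) + ((y (ee, i, j, true) : ℝ) : ℂ) * Complex.I) a.1)).prod)).trace.re) with hfp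
  have hfpC : ContDiff ℝ 3 fp := contDiff_loopAverage _ _
  have hval : ∀ VV : (GaugeConfig 3 L (Matrix.specialUnitaryGroup (Fin 2) ℂ)), fp (co VV) = (((Fintype.card (Site 3 L) : ℝ))⁻¹ * ∑ x : Site 3 L, wilsonLoop (fundamentalRep (Fin 2)) x i j R T VV) := fun VV => loopAverage_coords_eq VV i j R T
  have hlen : (((((List.range R).map (fun m : ℕ => ((Pi.single i ((m : ℕ) : ZMod L) : Site 3 L), i, false)) ++ (List.range T).map (fun m : ℕ => ((Pi.single i ((R : ℕ) : ZMod L) : Site 3 L) + (Pi.single j ((m : ℕ) : ZMod L) : Site 3 L), j, false)) ++ ((List.range R).map (fun m : ℕ => ((Pi.single j ((T : ℕ) : ZMod L) : Site 3 L) + (Pi.single i ((m : ℕ) : ZMod L) : Site 3 L), i, true))).reverse ++ ((List.range T).map (fun m : ℕ => ((Pi.single j ((m : ℕ) : ZMod L) : Site 3 L), j, true))).reverse)).length : ℕ) : ℝ) = 2 * ((R : ℝ) + T) := by rw [rectShape_length]; push_cast; ring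
  have hs : 0 < 32 * ((2 * (Fintype.card (Site 3 L) : ℝ))⁻¹) ^ 2 * (((((List.range R).map (fun m : ℕ => ((Pi.single i ((m : ℕ) : ZMod L) : Site 3 L), i, false)) ++ (List.range T).map (fun m : ℕ => ((Pi.single i ((R : ℕ) : ZMod L) : Site 3 L) + (Pi.single j ((m : ℕ) : ZMod L) : Site 3 L), j, false)) ++ ((List.range R).map (fun m : ℕ => ((Pi.single j ((T : ℕ) : ZMod L) : Site 3 L) + (Pi.single i ((m : ℕ) : ZMod L) : Site 3 L), i, true))).reverse ++ ((List.range T).map (fun m : ℕ => ((Pi.single j ((m : ℕ) : ZMod L) : Site 3 L), j, true))).reverse)).length : ℕ) : ℝ) ^ 2 * Fintype.card (Edge 3 L) := by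
    have : 0 < ((2 * (Fintype.card (Site 3 L) : ℝ))⁻¹) ^ 2 := by positivity
    rw [hlen, card_edge_eq_three_mul_card_site]
    positivity
  have hmain : |(∫ ω, fp (co (U ((2 : ℝ≥0) + u) ω)) ∂P) - ∫ V, fp (co V) ∂μ| ≤
      Real.exp (-(2 * ρ) * u) * Real.sqrt ((32 * ((2 * (Fintype.card (Site 3 L) : ℝ))⁻¹) ^ 2 * (((((List.range R).map (fun m : ℕ => ((Pi.single i ((m : ℕ) : ZMod L) : Site 3 L), i, false)) ++ (List.range T).map (fun m : ℕ => ((Pi.single i ((R : ℕ) : ZMod L) : Site 3 L) + (Pi.single j ((m : ℕ) : ZMod L) : Site 3 L), j, false)) ++ ((List.range R).map (fun m : ℕ => ((Pi.single j ((T : ℕ) : ZMod L) : Site 3 L) + (Pi.single i ((m : ℕ) : ZMod L) : Site 3 L), i, true))).reverse ++ ((List.range T).map (fun m : ℕ => ((Pi.single j ((m : ℕ) : ZMod L) : Site 3 L), j, true))).reverse)).length : ℕ) : ℝ) ^ 2 * Fintype.card (Edge 3 L)) * (366 * |β'| * (L : ℝ) ^ 3 + 3 * Real.log (3 / 2) *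 (L : ℝ) ^ 3 + Real.log 2) / (2 * ρ)) :=
    wilson_coldStart_smooth_le_exp_of_logSobolev_explicit L β' fp hρ hfpC hs hLSgen hW z hU0 hU u (wilson_loopAverage_carre_le L β' _ _)
  have hEP : ∫ ω, fp (co (U ((2 : ℝ≥0) + u) ω)) ∂P = ∫ ω, (((Fintype.card (Site 3 L) : ℝ))⁻¹ * ∑ x : Site 3 L, wilsonLoop (fundamentalRep (Fin 2)) x i j R T (U ((2 : ℝ≥0) + u) ω)) ∂P :=
    integral_congr_ae (ae_of_all _ fun ω => by beta_reduce; rw [hval])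
  have hEμ : ∫ V, fp (co V) ∂μ = ∫ V, (((Fintype.card (Site 3 L) : ℝ))⁻¹ * ∑ x : Site 3 L, wilsonLoop (fundamentalRep (Fin 2)) x i j R T V) ∂μ :=
    integral_congr_ae (ae_of_all _ fun V => by beta_reduce; rw [hval])
  have e2 : (32 * ((2 * (Fintype.card (Site 3 L) : ℝ))⁻¹) ^ 2 * (((((List.range R).map (fun m : ℕ => ((Pi.single i ((m : ℕ) : ZMod L) : Site 3 L), i, false)) ++ (List.range T).map (fun m : ℕ => ((Pi.single i ((R : ℕ) : ZMod L) : Site 3 L) + (Pi.single j ((m : ℕ) : ZMod L) : Site 3 L), j, false)) ++ ((List.range R).map (fun m : ℕ => ((Pi.single j ((T : ℕ) : ZMod L) : Site 3 L) + (Pi.single i ((m : ℕ) : ZMod L) : Site 3 L), i, true))).reverse ++ ((List.range T).map (fun m : ℕ => ((Pi.single j ((m : ℕ) : ZMod L) : Site 3 L), j, true))).reverse)).length : ℕ) : ℝ) ^ 2 * Fintype.card (Edge 3 L)) * (366 * |β'| * (L : ℝ) ^ 3 + 3 * Real.log (3 / 2) * (L : ℝ) ^ 3 + Real.log 2) / (2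 * ρ) =
      96 * ((R : ℝ) + T) ^ 2 * (366 * |β'| * (L : ℝ) ^ 3 + 3 * Real.log (3 / 2) * (L : ℝ) ^ 3 + Real.log 2) / ((Fintype.card (Site 3 L) : ℝ) * (2 * ρ)) := by
    rw [hlen, card_edge_eq_three_mul_card_site]
    field_simp
    ring
  rw [hEP, hEμ, e2] at hmain
  exact hmain

/-- ★★ **Volume factors cancelled**: under log-Sobolev(`ρ`), for `R + T > 0`, every deterministic start, every solution and every `u ≥ 0`,
`|E W̄(U_(2+u)) − ∫ W̄ dμ_(β')| ≤ e^(−2ρu) · (R+T) · √(48·(366|β'| + 3)/ρ)` (`B_L ≤ (366|β'| + 3)·L³ = (366|β'| + 3)·#sites`): the prefactor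
depends on the torus size and on the coupling only through `β'` and `ρ`. [cite: BakryGentilLedoux2014, Thm 5.2.1] -/
theorem wilson_coldStart_loopAverage_le_coupling_of_logSobolev (L : ℕ) [NeZero L] (β' : ℝ) (i j : Fin 3) {ρ : ℝ} (hρ : 0 < ρ) (R T : ℕ)
    (hRT : 0 < R + T) (z : (GaugeConfig 3 L (Matrix.specialUnitaryGroup (Fin 2) ℂ)))
    (hLSgen : ∀ (f : (Edge 3 L × Fin 2 × Fin 2 × Bool → ℝ) → ℝ), ContDiff ℝ 3 f →
        let coords : GaugeConfig 3 L (Matrix.specialUnitaryGroup (Fin 2) ℂ) → (Edge 3 L × Fin 2 × Fin 2 × Bool → ℝ) :=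
          fun V q => (fun z : ℂ => if q.2.2.2 then z.im else z.re)
            ((fundamentalRep (Fin 2) (V q.1) : Matrix (Fin 2) (Fin 2) ℂ) q.2.1 q.2.2.1)
        let gen : GaugeConfig 3 L (Matrix.specialUnitaryGroup (Fin 2) ℂ) → ℝ := fun V =>
          (∑ i : Edge 3 L × Fin 2 × Fin 2 × Bool, fderiv ℝ f (coords V) (Pi.single i 1) *
              (fun z : ℂ => if i.2.2.2 then z.im else z.re)
                ((latticeLangevinDynamics (fundamentalLatticeRep 2) β').drift
                  (matrixConfig (fundamentalRep (Fin 2)) V) i.1 i.2.1 i.2.2.1) +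
          1 / 2 * ∑ i : Edge 3 L × Fin 2 × Fin 2 × Bool, ∑ j : Edge 3 L × Fin 2 × Fin 2 × Bool,
            fderiv ℝ (fun z => fderiv ℝ f z (Pi.single i 1)) (coords V) (Pi.single j 1) *
              ∑ n : Edge 3 L × NoiseIdx 2,
                (if n.1 = i.1 then (fun z : ℂ => if i.2.2.2 then z.im else z.re)
                  ((latticeLangevinDynamics (fundamentalLatticeRep 2) β').noise
                    (matrixConfig (fundamentalRep (Fin 2)) V) i.1 n.2 i.2.1 i.2.2.1) else 0) *
                (if n.1 = j.1 then (fun z : ℂ => if j.2.2.2 then z.im else z.re)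
                  ((latticeLangevinDynamics (fundamentalLatticeRep 2) β').noise
                    (matrixConfig (fundamentalRep (Fin 2)) V) j.1 n.2 j.2.1 j.2.2.1) else 0))
        ρ * ((∫ V, f (coords V) ^ 2 * Real.log (f (coords V) ^ 2) ∂(wilsonMeasure (d := 3) (L := L) (fundamentalRep (Fin 2)) β')) -
            (∫ V, f (coords V) ^ 2 ∂(wilsonMeasure (d := 3) (L := L) (fundamentalRep (Fin 2)) β')) *
              Real.log (∫ V, f (coords V) ^ 2 ∂(wilsonMeasure (d := 3) (L := L) (fundamentalRep (Fin 2)) β'))) ≤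
          -∫ V, f (coords V) * gen V ∂(wilsonMeasure (d := 3) (L := L) (fundamentalRep (Fin 2)) β'))
    {Ω : Type} [MeasurableSpace Ω] {P : Measure Ω} [IsProbabilityMeasure P]
    {W : ℝ≥0 → Ω → (Edge 3 L × NoiseIdx 2 → ℝ)} (hW : IsFlatBrownian W P)
    {U : ℝ≥0 → Ω → (GaugeConfig 3 L (Matrix.specialUnitaryGroup (Fin 2) ℂ))} (hU0 : ∀ ω, U 0 ω = z)
    (hU : (latticeLangevinDynamics (fundamentalLatticeRep 2) β').IsSolution (fundamentalRep (Fin 2)) hW.natFiltration P W U)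
    (u : ℝ≥0) :
    |(∫ ω, (((Fintype.card (Site 3 L) : ℝ))⁻¹ * ∑ x : Site 3 L, wilsonLoop (fundamentalRep (Fin 2)) x i j R T (U ((2 : ℝ≥0) + u) ω)) ∂P) - ∫ V, (((Fintype.card (Site 3 L) : ℝ))⁻¹ * ∑ x : Site 3 L, wilsonLoop (fundamentalRep (Fin 2)) x i j R T V) ∂(wilsonMeasure (d := 3) (L := L) (fundamentalRep (Fin 2)) β')| ≤
      Real.exp (-(2 * ρ) * u) * (((R : ℝ) + T) * Real.sqrt (48 * (366 * |β'| + 3) / ρ)) := by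
  have h2ρ : 0 < 2 * ρ := by positivity
  have hRT' : (0 : ℝ) < (R : ℝ) + T := by exact_mod_cast hRT
  have h := wilson_coldStart_loopAverage_le_exp_of_logSobolev L β' hρ i j R T hRT z hLSgen hW hU0 hU u
  refine h.trans (mul_le_mul_of_nonneg_left ?_ (Real.exp_pos _).le)
  have hSite : (Fintype.card (Site 3 L) : ℝ) = (L : ℝ) ^ 3 := by
    rw [card_site_three]; push_cast; ring
  have hL1 : (1 : ℝ) ≤ (L : ℝ) := by exact_mod_cast Nat.one_le_iff_ne_zero.2 (NeZero.ne L)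
  have hL3 : (1 : ℝ) ≤ (L : ℝ) ^ 3 := one_le_pow₀ hL1
  have hL30 : (0 : ℝ) < (L : ℝ) ^ 3 := by positivity
  -- `B_L ≤ (366|β'| + 3) L³`
  have h32 : Real.log (3 / 2 : ℝ) ≤ 1 / 2 := by
    have := Real.log_le_sub_one_of_pos (by norm_num : (0 : ℝ) < 3 / 2); linarith
  have h2 : Real.log (2 : ℝ) ≤ 1 := by
    have := Real.log_le_sub_one_of_pos (by norm_num : (0 : ℝ) < 2); linarith
  have hB : (366 * |β'| * (L : ℝ) ^ 3 + 3 * Real.log (3 / 2) * (L : ℝ) ^ 3 + Real.log 2) ≤ (366 * |β'| + 3) * (L : ℝ) ^ 3 := by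
    nlinarith [mul_le_mul_of_nonneg_right h32 hL30.le, abs_nonneg β']
  have hq : 96 * ((R : ℝ) + T) ^ 2 * (366 * |β'| * (L : ℝ) ^ 3 + 3 * Real.log (3 / 2) * (L : ℝ) ^ 3 + Real.log 2) / ((Fintype.card (Site 3 L) : ℝ) * (2 * ρ)) ≤ (((R : ℝ) + T) * Real.sqrt (48 * (366 * |β'| + 3) / ρ)) ^ 2 := by
    rw [mul_pow, Real.sq_sqrt (by positivity), hSite]
    rw [div_le_iff₀ (by positivity)]
    have hRT2 : 0 < ((R : ℝ) + T) ^ 2 := by positivity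
    have e : ((R : ℝ) + T) ^ 2 * (48 * (366 * |β'| + 3) / ρ) * ((L : ℝ) ^ 3 * (2 * ρ)) = 96 * ((R : ℝ) + T) ^ 2 * ((366 * |β'| + 3) * (L : ℝ) ^ 3) := by
      field_simp
      ring
    rw [e]
    exact mul_le_mul_of_nonneg_left hB (by positivity)
  exact (Real.sqrt_le_sqrt hq).trans (le_of_eq (Real.sqrt_sq (by positivity)))

end Summit.QuantumFields.YangMills.Theorems.ColdStartUniversality
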